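import Literature.Analysis.FluidPDE.KatoRieszPressureSuitable
import Literature.Analysis.FluidPDE.KatoMaximalTimeSingular
import Literature.Analysis.FluidPDE.ClassicalSuitable
import Literature.Analysis.FluidPDE.SuitableWeakPressure
import HarnessLib

/-!
# The pressure pairing of the classical representative of a Kato solution is the Riesz pairing

Analysis/FluidPDE support file (theorems only) on the discharge path of
`Literature.Analysis.FluidPDE.GIP2003_L3_stability` (Gallagher–Iftimie–Planchon 2003, Thm. 0.1 (i)).
In the classical local energy identity of the caloric remainder
(`GIP2003.remainder_local_energy_identity`, file `GIPRemainderEnergyIdentity.lean`) the pressure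
enters through the pairing `∫ π(t) ⟪V(t), ∇φ⟫` of the *classical* pressure `π` of the smooth
representative `(w, π)` of the mild solution (`mild_L3_smooth_holds`: Giga 1986, Thm. 4;
Lemarié-Rieusset 2016, Thm. 15.1 (A)) with a smooth divergence-free field `V` and a cutoff `φ`.
The classical pressure is only determined up to a function of time; what controls the pairing
at spatial infinity is the **Riesz pressure** `Π[u(t)] = Σ ℛᵢℛⱼ(uᵢuⱼ)(t) ∈ L^{3/2}` of the mild
solution (Lemarié-Rieusset 2016, Def. 6.9 / Prop. 6.5: mild solutions are Oseen solutions,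
`∇p = -(Id - ℙ) div(u ⊗ u)`; tree: `IsKatoSolutionOn.exists_rieszPressure_suitable_slab`). This
file proves that the two pairings agree for a.e. `t`, whence Stein's bound for the classical
pairing (`GIP2003.ae_enorm_pressure_pairing_le`):

  `‖∫ π(t) ⟪V(t), ∇φ⟫‖ ≤ C_{3/2} ‖u(t)‖₃² ‖⟪V(t), ∇φ⟫‖₃` for a.e. `t ∈ (0, S)`.

Proof: both `(u, Π)` (tree) and `(w, π)` (classical ⇒ distributional,
`isDistributionalNSSolutionOn_of_contDiffOn`) solve the equations in `𝒟'` on the slab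
`(0, S) × ℝ³`, and `w = u` a.e. there; testing the two momentum identities with
`Ψ = θ(t) φ(x) V(t, x)` and subtracting leaves `∫₀ˢ θ(t) ∫ (Π - π)(t) ⟪V(t), ∇φ⟫ dx dt = 0` for
every `θ ∈ C_c^∞((0, S))`, so the inner integral vanishes for a.e. `t` (fundamental lemma of the
calculus of variations).

## References

* I. Gallagher, D. Iftimie, F. Planchon, Ann. Inst. Fourier 53 (2003), proof of Thm. 2.1
  (the pressure-free energy estimate (8)). [GallagherIftimiePlanchon2003]
* P. G. Lemarié-Rieusset, *The Navier–Stokes Problem in the 21st Century*, CRC Press 2016,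
  Def. 6.9, Prop. 6.5, Prop. 6.2; Thm. 15.1 (A). [LemarieRieusset2016]
-/

noncomputable section

open MeasureTheory TopologicalSpace Set Function Filter Metric InnerProductSpace
open _root_.Topology
open scoped ENNReal NNReal RealInnerProductSpace Laplacian

namespace Literature.Analysis.FluidPDE

namespace GIP2003

/-! ### A test field on a slab from a field smooth on the slab -/

section TestField

variable {E : Type*} [NormedAddCommGroup E] [NormedSpace ℝ E]
variable {F : Type*} [NormedAddCommGroup F] [NormedSpace ℝ F]

/-- **`θ(t) φ(x) V(t, x)` is a space–time test field on the slab `I × E`** when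
`θ ∈ C_c^∞(I)` (`I` open), `φ ∈ C_c^∞(E)` and `V` is jointly smooth on `I × E` (at points of the
slab by the product rule, near the other points because `θ` vanishes identically there; the
pattern of Caffarelli–Kohn–Nirenberg 1982, §2, admissible tests `φ u`). [folklore] -/
theorem isSpaceTimeTestOn_slab_smul {I : Set ℝ} (hI : IsOpen I) {θ : ℝ → ℝ}
    (hθ : ContDiff ℝ (⊤ : ℕ∞) θ) (hθc : HasCompactSupport θ) (hθI : tsupport θ ⊆ I)
    {φ : E → ℝ} (hφ : ContDiff ℝ (⊤ : ℕ∞) φ) (hφc : HasCompactSupport φ)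
    {V : ℝ → E → F} (hV : IsSmoothSpaceTimeOn I V) :
    IsSpaceTimeTestOn (slab E I hI) fun t x => (θ t * φ x) • V t x := by
  have hsc : ContDiff ℝ (⊤ : ℕ∞) fun z : ℝ × E => θ z.1 * φ z.2 :=
    (hθ.comp contDiff_fst).mul (hφ.comp contDiff_snd)
  have heq : uncurry (fun t x => (θ t * φ x) • V t x) =
      fun z : ℝ × E => (θ z.1 * φ z.2) • uncurry V z := rfl
  have hopen : IsOpen (I ×ˢ (univ : Set E)) := hI.prod isOpen_univ
  refine ⟨?_, ?_, ?_⟩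
  · rw [heq]
    refine contDiff_iff_contDiffAt.2 fun z => ?_
    by_cases hz : z.1 ∈ I
    · have hV' : ContDiffOn ℝ (⊤ : ℕ∞) (uncurry V) (I ×ˢ univ) := hV
      exact hsc.contDiffAt.smul (hV'.contDiffAt (hopen.mem_nhds ⟨hz, mem_univ _⟩))
    · have hz' : z.1 ∉ tsupport θ := fun h => hz (hθI h)
      have hev : (fun w : ℝ × E => (θ w.1 * φ w.2) • uncurry V w) =ᶠ[𝓝 z] fun _ => 0 := by
        have hnhds : (tsupport θ)ᶜ ×ˢ (univ : Set E) ∈ 𝓝 z :=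
          ((isClosed_tsupport θ).isOpen_compl.prod isOpen_univ).mem_nhds ⟨hz', mem_univ _⟩
        filter_upwards [hnhds] with w hw
        rw [image_eq_zero_of_notMem_tsupport hw.1, zero_mul, zero_smul]
      exact (contDiffAt_const (c := (0 : F))).congr_of_eventuallyEq hev
  · rw [heq]
    refine HasCompactSupport.smul_right ?_
    refine HasCompactSupport.intro (hθc.prod hφc) fun z hz => ?_
    rcases not_and_or.1 (fun h => hz (mem_prod.2 h)) with h1 | h2
    · rw [image_eq_zero_of_notMem_tsupport h1, zero_mul]
    · rw [image_eq_zero_of_notMem_tsupport h2, mul_zero]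
  · rw [heq]
    refine (tsupport_smul_subset_left _ _).trans ?_
    -- `tsupport (θ φ) ⊆ tsupport θ × E ⊆ I × E`
    have hsub : support (fun z : ℝ × E => θ z.1 * φ z.2) ⊆ tsupport θ ×ˢ (univ : Set E) := by
      intro z hz
      refine ⟨subset_tsupport _ ?_, mem_univ _⟩
      exact fun h => hz (show θ z.1 * φ z.2 = 0 by rw [h, zero_mul])
    have hcl : IsClosed (tsupport θ ×ˢ (univ : Set E)) := (isClosed_tsupport θ).prod isClosed_univ
    intro z hz
    exact mem_slab.2 (hθI (hcl.closure_subset_iff.2 hsub hz).1)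

end TestField

/-! ### Classical solutions are distributional on slabs -/

section Classical

/-- A classical solution of the unforced equations on the open strip `(0, T)` is a distributional
solution on every slab `(0, S) × ℝ³`, `S ≤ T` (`isDistributionalNSSolutionOn_of_contDiffOn`;
Caffarelli–Kohn–Nirenberg 1982, §2, (2.2)). [folklore] -/
theorem isDistributionalNSSolutionOn_slab_of_classical {ν T S : ℝ} (hST : S ≤ T)
    {w : ℝ → EuclideanSpace ℝ (Fin 3) → EuclideanSpace ℝ (Fin 3)}
    {π : ℝ → EuclideanSpace ℝ (Fin 3) → ℝ} (hcl : IsClassicalNSSolutionOn (Ioo 0 T) ν 0 w π) :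
    IsDistributionalNSSolutionOn (slab (EuclideanSpace ℝ (Fin 3)) (Ioo 0 S) isOpen_Ioo) ν 0 w π := by
  have hQ : ((slab (EuclideanSpace ℝ (Fin 3)) (Ioo 0 S) isOpen_Ioo : Opens (ℝ × EuclideanSpace ℝ (Fin 3))) :
      Set (ℝ × EuclideanSpace ℝ (Fin 3))) ⊆ Ioo 0 T ×ˢ univ := by
    rw [coe_slab]
    exact prod_mono (Ioo_subset_Ioo_right hST) Subset.rfl
  have hw2 : ContDiffOn ℝ 2 (uncurry w) (Ioo 0 T ×ˢ univ) :=
    hcl.smooth_velocity.of_le (by norm_cast)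
  have hp1 : ContDiffOn ℝ 1 (uncurry π) (Ioo 0 T ×ˢ univ) :=
    hcl.smooth_pressure.of_le (by norm_cast)
  have hf : ContinuousOn (uncurry (0 : ℝ → EuclideanSpace ℝ (Fin 3) → EuclideanSpace ℝ (Fin 3)))
      (Ioo 0 T ×ˢ univ) := continuousOn_const
  refine isDistributionalNSSolutionOn_of_contDiffOn isOpen_Ioo hQ hw2 hp1 hf (fun t ht x => ?_)
    hcl.divFree
  have hm := hcl.momentum t ht x
  rwa [timeDerivWithin_eq_deriv isOpen_Ioo ht, ← timeDeriv_apply] at hm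

end Classical

/-! ### The swap -/

section Swap

variable {T S ν : ℝ} {u₀ : EuclideanSpace ℝ (Fin 3) → EuclideanSpace ℝ (Fin 3)}
  {u w V : ℝ → EuclideanSpace ℝ (Fin 3) → EuclideanSpace ℝ (Fin 3)}
  {π : ℝ → EuclideanSpace ℝ (Fin 3) → ℝ} {φ : EuclideanSpace ℝ (Fin 3) → ℝ}

/-- The restriction of Lebesgue measure to a strip `s × ℝ³` is the product of the restricted
time measure with Lebesgue measure on `ℝ³`. [folklore] -/
theorem volume_restrict_prod_univ_eq_prod (s : Set ℝ) :
    ((volume : Measure (ℝ × EuclideanSpace ℝ (Fin 3))).restrict (s ×ˢ univ)) =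
      ((volume : Measure ℝ).restrict s).prod (volume : Measure (EuclideanSpace ℝ (Fin 3))) := by
  rw [Measure.volume_eq_prod, ← Measure.restrict_univ (μ := (volume : Measure (EuclideanSpace ℝ (Fin 3)))),
    Measure.prod_restrict, Measure.restrict_univ]

/-- **The classical pressure pairing is the Riesz pressure pairing, for a.e. time** (GIP 2003,
proof of Thm. 2.1, the pressure in the energy estimate (8); Lemarié-Rieusset 2016, Def. 6.9 /
Prop. 6.5: the pressure of a mild solution is the Riesz pressure up to a function of time). Let
`u` be a Kato solution on `[0, T)` with viscosity `ν > 0`, `0 < S < T`, `(w, π)` a classical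
solution on the open strip `(0, T)` with `w(t) = u(t)` a.e. for every `t ∈ (0, T)`, `V` a field
jointly smooth on the strip with divergence-free slices, and `φ ∈ C_c^∞(ℝ³)`. Then there is a
pressure `p` on the slab `(0, S) × ℝ³` whose slices are in `L^{3/2}` with Stein's bound
`‖p(t)‖_{3/2} ≤ C_{3/2}‖u(t)‖₃²` for a.e. `t`, and for a.e. `t ∈ (0, S)`
`∫ π(t) ⟪V(t), ∇φ⟫ = ∫ p(t) ⟪V(t), ∇φ⟫`.
[cite: GallagherIftimiePlanchon2003, Thm. 2.1 (proof, (8))] [cite: LemarieRieusset2016, Def. 6.9 and Prop. 6.5] -/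
theorem ae_pressure_pairing_eq (hν : 0 < ν) (hu : IsKatoSolutionOn T ν u₀ u) (hS : 0 < S)
    (hST : S < T) (hcl : IsClassicalNSSolutionOn (Ioo 0 T) ν 0 w π)
    (hwu : ∀ t ∈ Ioo 0 T, w t =ᵐ[volume] u t) (hV : IsSmoothSpaceTimeOn (Ioo 0 T) V)
    (hdivV : ∀ t ∈ Ioo 0 T, VectorCalculus.IsDivFree (V t)) (hφ : ContDiff ℝ (⊤ : ℕ∞) φ)
    (hφc : HasCompactSupport φ) :
    ∃ p : ℝ → EuclideanSpace ℝ (Fin 3) → ℝ,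
      (∀ᵐ t ∂((volume : Measure ℝ).restrict (Ioo 0 S)), MemLp (p t) (3 / 2 : ℝ≥0∞) volume ∧
        eLpNorm (p t) (3 / 2 : ℝ≥0∞) volume ≤ steinConstThreeHalves * eLpNorm (u t) 3 volume ^ 2) ∧
      ∀ᵐ t ∂((volume : Measure ℝ).restrict (Ioo 0 S)),
        ∫ x, π t x * ⟪V t x, gradient φ x⟫ = ∫ x, p t x * ⟪V t x, gradient φ x⟫ := by
  haveI hHT31 : ENNReal.HolderTriple (3 / 2) 3 1 := by
    refine ⟨?_⟩
    rw [ENNReal.inv_div (Or.inr (by norm_num)) (Or.inr (by norm_num)), inv_one,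
      show (3 : ℝ≥0∞)⁻¹ = 1 / 3 by rw [one_div], ENNReal.div_add_div_same,
      show (2 : ℝ≥0∞) + 1 = 3 by norm_num, ENNReal.div_self (by norm_num) (by norm_num)]
  obtain ⟨p, hpm, hp32, hsl, -, hsuit⟩ := hu.exists_rieszPressure_suitable_slab hν hS hST
  obtain ⟨hlocu, hlocu2, hlocp, -, hmomu⟩ := hsuit.distributional
  obtain ⟨-, -, hlocπ, -, hmomw⟩ := isDistributionalNSSolutionOn_slab_of_classical hST.le hcl
  refine ⟨p, hsl.mono fun t ht => ⟨ht.2.1, ht.2.2⟩, ?_⟩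
  -- ### notation
  set Ω : Opens (ℝ × EuclideanSpace ℝ (Fin 3)) := slab (EuclideanSpace ℝ (Fin 3)) (Ioo 0 S) isOpen_Ioo
    with hΩ
  have hΩset : (Ω : Set (ℝ × EuclideanSpace ℝ (Fin 3))) = Ioo 0 S ×ˢ univ := coe_slab _ _
  have hΩT : (Ω : Set (ℝ × EuclideanSpace ℝ (Fin 3))) ⊆ Ioo 0 T ×ˢ univ := by
    rw [hΩset]; exact prod_mono (Ioo_subset_Ioo_right hST.le) Subset.rfl
  set ψ : ℝ → EuclideanSpace ℝ (Fin 3) → ℝ := fun t x => ⟪V t x, gradient φ x⟫ with hψ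
  set g : ℝ → ℝ := fun t => ∫ x, (p t x - π t x) * ψ t x with hg
  have hprod := volume_restrict_prod_univ_eq_prod (Ioo 0 S)
  -- continuity of `V`, `π` on the strip `(0, T)`, of `ψ`
  have hVc : ContinuousOn (uncurry V) (Ioo 0 T ×ˢ univ) := hV.continuousOn
  have hπc : ContinuousOn (uncurry π) (Ioo 0 T ×ˢ univ) := hcl.smooth_pressure.continuousOn
  have hgφc : Continuous (gradient φ) := continuous_gradient_of_contDiff (hφ.of_le (by norm_cast))
  have hψc : ContinuousOn (uncurry ψ) (Ioo 0 T ×ˢ univ) :=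
    ContinuousOn.inner hVc (hgφc.comp continuous_snd).continuousOn
  have hψK : ∀ t x, x ∉ tsupport φ → ψ t x = 0 := fun t x hx => by
    simp only [hψ, gradient_eq_zero_of_notMem_tsupport hx, inner_zero_right]
  -- ### Step 1: `w = u` a.e. on the strip `(0, S) × ℝ³`
  have hwm : AEStronglyMeasurable (uncurry w)
      ((volume : Measure (ℝ × EuclideanSpace ℝ (Fin 3))).restrict (Ioo 0 S ×ˢ univ)) :=
    (hcl.smooth_velocity.continuousOn.mono (prod_mono (Ioo_subset_Ioo_right hST.le) Subset.rfl)).aestronglyMeasurable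
      (measurableSet_Ioo.prod MeasurableSet.univ)
  have hum : AEStronglyMeasurable (uncurry u)
      ((volume : Measure (ℝ × EuclideanSpace ℝ (Fin 3))).restrict (Ioo 0 S ×ˢ univ)) :=
    hu.aestronglyMeasurable.mono_measure
      (Measure.restrict_mono (prod_mono (Ioo_subset_Ioo_right hST.le) Subset.rfl) le_rfl)
  have hae : uncurry w =ᵐ[(volume : Measure (ℝ × EuclideanSpace ℝ (Fin 3))).restrict (Ioo 0 S ×ˢ univ)]
      uncurry u :=
    ae_restrict_prod_of_forall_ae_eq (fun t ht => hwu t ⟨ht.1, ht.2.trans hST⟩) hwm hum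
  -- ### Step 2: `∫ θ g = 0` for every `θ ∈ C_c^∞((0, S))`
  have hstep2 : ∀ θ : ℝ → ℝ, ContDiff ℝ (⊤ : ℕ∞) θ → HasCompactSupport θ → tsupport θ ⊆ Ioo 0 S →
      ∫ t in Ioo 0 S, θ t * g t = 0 := by
    intro θ hθ hθc hθS
    -- the test field `Ψ = θ φ V`
    set Ψ : ℝ → EuclideanSpace ℝ (Fin 3) → EuclideanSpace ℝ (Fin 3) := fun t x => (θ t * φ x) • V t x
      with hΨdef
    have hΨ : IsSpaceTimeTestOn Ω Ψ :=
      isSpaceTimeTestOn_slab_smul isOpen_Ioo hθ hθc hθS hφ hφc (hV.mono (Ioo_subset_Ioo_right hST.le))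
    set K : Set (ℝ × EuclideanSpace ℝ (Fin 3)) := tsupport (uncurry Ψ) with hKdef
    have hKc : IsCompact K := hΨ.hasCompactSupport
    have hKΩ : K ⊆ (Ω : Set (ℝ × EuclideanSpace ℝ (Fin 3))) := hΨ.tsupport_subset
    -- vanishing of the test derivatives off `K`
    have hnear : ∀ z : ℝ × EuclideanSpace ℝ (Fin 3), z ∉ K →
        Ψ z.1 =ᶠ[𝓝 z.2] fun _ => (0 : EuclideanSpace ℝ (Fin 3)) := fun z hz => by
      have h0 : uncurry Ψ =ᶠ[𝓝 (z.1, z.2)] 0 := notMem_tsupport_iff_eventuallyEq.1 hz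
      have hc : Continuous fun y : EuclideanSpace ℝ (Fin 3) => (z.1, y) := continuous_const.prodMk continuous_id
      exact (hc.tendsto z.2).eventually h0
    have hΨtK : ∀ z : ℝ × EuclideanSpace ℝ (Fin 3), z ∉ K → timeDeriv Ψ z.1 z.2 = 0 := fun z hz =>
      IsSpaceTimeTestOn.timeDeriv_eq_zero_of_notMem hz
    have hDΨK : ∀ z : ℝ × EuclideanSpace ℝ (Fin 3), z ∉ K → fderiv ℝ (Ψ z.1) z.2 = 0 := fun z hz => by
      rw [(hnear z hz).fderiv_eq, fderiv_fun_const, Pi.zero_apply]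
    have hLΨK : ∀ z : ℝ × EuclideanSpace ℝ (Fin 3), z ∉ K → (Δ (Ψ z.1)) z.2 = 0 := fun z hz => by
      rw [(InnerProductSpace.laplacian_congr_nhds (hnear z hz)).self_of_nhds,
        InnerProductSpace.laplacian_const, Pi.zero_apply]
    obtain ⟨hdivΨ_c, hdivΨK⟩ := hΨ.continuous_divergence_field
    have hΨt_c : Continuous fun z : ℝ × EuclideanSpace ℝ (Fin 3) => timeDeriv Ψ z.1 z.2 :=
      hΨ.continuous_timeDeriv
    have hDΨ_c : Continuous fun z : ℝ × EuclideanSpace ℝ (Fin 3) => fderiv ℝ (Ψ z.1) z.2 :=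
      hΨ.continuous_fderiv_slice
    have hLΨ_c : Continuous fun z : ℝ × EuclideanSpace ℝ (Fin 3) => (Δ (Ψ z.1)) z.2 :=
      hΨ.continuous_laplacian_slice
    -- ### integrability of the pieces of the momentum pairing of `(u, p)`
    have iT : Integrable (fun z : ℝ × EuclideanSpace ℝ (Fin 3) => ⟪u z.1 z.2, timeDeriv Ψ z.1 z.2⟫) volume :=
      integrable_inner_of_locallyIntegrableOn hlocu hΨt_c hKc hKΩ hΨtK
    have iL : Integrable (fun z : ℝ × EuclideanSpace ℝ (Fin 3) => ⟪u z.1 z.2, (Δ (Ψ z.1)) z.2⟫) volume :=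
      integrable_inner_of_locallyIntegrableOn hlocu hLΨ_c hKc hKΩ hLΨK
    have iP : Integrable (fun z : ℝ × EuclideanSpace ℝ (Fin 3) =>
        uncurry p z * VectorCalculus.divergence (Ψ z.1) z.2) volume :=
      integrable_mul_of_locallyIntegrableOn hlocp hdivΨ_c hKc hKΩ hdivΨK
    have iD : Integrable (fun z : ℝ × EuclideanSpace ℝ (Fin 3) =>
        (uncurry p - uncurry π) z * VectorCalculus.divergence (Ψ z.1) z.2) volume :=
      integrable_mul_of_locallyIntegrableOn (hlocp.sub hlocπ) hdivΨ_c hKc hKΩ hdivΨK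
    -- the quadratic term
    have iC : Integrable (fun z : ℝ × EuclideanSpace ℝ (Fin 3) =>
        ⟪u z.1 z.2, convect (u z.1) (Ψ z.1) z.2⟫) volume := by
      have huK : IntegrableOn (uncurry u) K volume := hlocu.integrableOn_compact_subset hKΩ hKc
      have huK2 : IntegrableOn (fun z => ‖uncurry u z‖ ^ 2) K volume :=
        hlocu2.integrableOn_compact_subset hKΩ hKc
      have hDc : HasCompactSupport fun z : ℝ × EuclideanSpace ℝ (Fin 3) => fderiv ℝ (Ψ z.1) z.2 :=
        HasCompactSupport.intro hKc fun z hz => hDΨK z hz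
      obtain ⟨C, hC⟩ := hDΨ_c.norm.bounded_above_of_compact_support hDc.norm
      have hmeas : AEStronglyMeasurable (fun z : ℝ × EuclideanSpace ℝ (Fin 3) =>
          ⟪u z.1 z.2, convect (u z.1) (Ψ z.1) z.2⟫) (volume.restrict K) := by
        refine huK.aestronglyMeasurable.inner ?_
        exact isBoundedBilinearMap_apply.continuous.comp_aestronglyMeasurable
          (hDΨ_c.aestronglyMeasurable.prodMk huK.aestronglyMeasurable)
      have hbound : ∀ᵐ z ∂(volume.restrict K), ‖⟪u z.1 z.2, convect (u z.1) (Ψ z.1) z.2⟫‖ ≤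
          C * ‖uncurry u z‖ ^ 2 := by
        refine Eventually.of_forall fun z => ?_
        rw [convect_apply]
        calc ‖⟪u z.1 z.2, fderiv ℝ (Ψ z.1) z.2 (u z.1 z.2)⟫‖
            ≤ ‖u z.1 z.2‖ * ‖fderiv ℝ (Ψ z.1) z.2 (u z.1 z.2)‖ := norm_inner_le_norm _ _
          _ ≤ ‖u z.1 z.2‖ * (‖fderiv ℝ (Ψ z.1) z.2‖ * ‖u z.1 z.2‖) := by
              gcongr; exact ContinuousLinearMap.le_opNorm _ _
          _ ≤ ‖u z.1 z.2‖ * (C * ‖u z.1 z.2‖) := by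
              gcongr; exact (le_abs_self _).trans (by simpa using hC z)
          _ = C * ‖uncurry u z‖ ^ 2 := by simp only [uncurry]; ring
      have hK' : IntegrableOn (fun z : ℝ × EuclideanSpace ℝ (Fin 3) =>
          ⟪u z.1 z.2, convect (u z.1) (Ψ z.1) z.2⟫) K volume :=
        Integrable.mono' (huK2.const_mul C) hmeas hbound
      refine (integrableOn_iff_integrable_of_support_subset fun z hz => ?_).1 hK'
      by_contra hzK
      refine hz ?_
      show ⟪u z.1 z.2, convect (u z.1) (Ψ z.1) z.2⟫ = 0
      rw [convect_apply, hDΨK z hzK]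
      simp
    -- the full momentum integrand of `(u, p)` is integrable
    set Np : ℝ × EuclideanSpace ℝ (Fin 3) → ℝ := fun z =>
      ⟪u z.1 z.2, timeDeriv Ψ z.1 z.2⟫ + ⟪u z.1 z.2, convect (u z.1) (Ψ z.1) z.2⟫ +
        ν * ⟪u z.1 z.2, (Δ (Ψ z.1)) z.2⟫ + p z.1 z.2 * VectorCalculus.divergence (Ψ z.1) z.2 +
        ⟪(0 : ℝ → EuclideanSpace ℝ (Fin 3) → EuclideanSpace ℝ (Fin 3)) z.1 z.2, Ψ z.1 z.2⟫ with hNp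
    have iN : Integrable Np volume := by
      have i0 : Integrable (fun z : ℝ × EuclideanSpace ℝ (Fin 3) =>
          ⟪(0 : ℝ → EuclideanSpace ℝ (Fin 3) → EuclideanSpace ℝ (Fin 3)) z.1 z.2, Ψ z.1 z.2⟫) volume := by
        have : (fun z : ℝ × EuclideanSpace ℝ (Fin 3) =>
            ⟪(0 : ℝ → EuclideanSpace ℝ (Fin 3) → EuclideanSpace ℝ (Fin 3)) z.1 z.2, Ψ z.1 z.2⟫) = fun _ => 0 := by
          funext z; simp
        rw [this]; exact integrable_zero _ _ _
      have := (((iT.add iC).add (iL.const_mul ν)).add iP).add i0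
      refine this.congr (Eventually.of_forall fun z => ?_)
      simp only [hNp, Pi.add_apply, uncurry]
    -- ### the two identities: `∫_Ω Np = 0` and `∫_Ω (Np - D) = 0`
    set D : ℝ × EuclideanSpace ℝ (Fin 3) → ℝ := fun z =>
      (uncurry p - uncurry π) z * VectorCalculus.divergence (Ψ z.1) z.2 with hD
    have h1 : ∫ z in (Ω : Set (ℝ × EuclideanSpace ℝ (Fin 3))), Np z = 0 := hmomu Ψ hΨ
    have h2 : ∫ z in (Ω : Set (ℝ × EuclideanSpace ℝ (Fin 3))), (Np z - D z) = 0 := by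
      have h2w := hmomw Ψ hΨ
      rw [← h2w]
      refine setIntegral_congr_ae Ω.isOpen.measurableSet ?_
      · have hae' : ∀ᵐ z ∂(volume : Measure (ℝ × EuclideanSpace ℝ (Fin 3))),
            z ∈ (Ω : Set (ℝ × EuclideanSpace ℝ (Fin 3))) → uncurry w z = uncurry u z := by
          rw [hΩset, ← ae_restrict_iff' (measurableSet_Ioo.prod MeasurableSet.univ)]
          exact hae
        filter_upwards [hae'] with z hz hzΩ
        have hwz : w z.1 z.2 = u z.1 z.2 := hz hzΩ
        simp only [hNp, hD, Pi.sub_apply, uncurry, convect_apply, hwz]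
        ring
    have hD0 : ∫ z in (Ω : Set (ℝ × EuclideanSpace ℝ (Fin 3))), D z = 0 := by
      have hsub : ∫ z in (Ω : Set (ℝ × EuclideanSpace ℝ (Fin 3))), (Np z - D z) =
          (∫ z in (Ω : Set (ℝ × EuclideanSpace ℝ (Fin 3))), Np z) -
            ∫ z in (Ω : Set (ℝ × EuclideanSpace ℝ (Fin 3))), D z :=
        integral_sub iN.integrableOn iD.integrableOn
      rw [hsub, h1, zero_sub] at h2
      exact neg_eq_zero.1 h2
    -- ### `∫_Ω D = ∫₀ˢ θ g`
    have hdivΨ : ∀ z : ℝ × EuclideanSpace ℝ (Fin 3), z.1 ∈ Ioo 0 T →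
        VectorCalculus.divergence (Ψ z.1) z.2 = θ z.1 * ψ z.1 z.2 := by
      intro z hz
      have hc : DifferentiableAt ℝ (fun y => θ z.1 * φ y) z.2 :=
        ((hφ.differentiable (by simp)).differentiableAt).const_mul _
      have hVd : DifferentiableAt ℝ (V z.1) z.2 :=
        ((hV.contDiff_slice hz).differentiable (by simp)).differentiableAt
      have hgrad : gradient (fun y => θ z.1 * φ y) z.2 = θ z.1 • gradient φ z.2 := by
        rw [gradient, gradient, fderiv_const_mul ((hφ.differentiable (by simp)).differentiableAt), map_smul]
      rw [show Ψ z.1 = fun y => (θ z.1 * φ y) • V z.1 y from rfl, divergence_smul_apply hc hVd,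
        hdivV z.1 hz z.2, mul_zero, zero_add, hgrad, real_inner_smul_right]
    have hDF : ∀ z ∈ Ioo 0 S ×ˢ (univ : Set (EuclideanSpace ℝ (Fin 3))),
        D z = θ z.1 * ((p z.1 z.2 - π z.1 z.2) * ψ z.1 z.2) := by
      intro z hz
      have hzT : z.1 ∈ Ioo 0 T := ⟨hz.1.1, hz.1.2.trans hST⟩
      simp only [hD, Pi.sub_apply, uncurry, hdivΨ z hzT]
      ring
    have hDint : ∫ z in (Ω : Set (ℝ × EuclideanSpace ℝ (Fin 3))), D z = ∫ t in Ioo 0 S, θ t * g t := by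
      rw [hΩset, setIntegral_congr_fun (measurableSet_Ioo.prod MeasurableSet.univ) hDF, hprod]
      have iF : Integrable (fun z : ℝ × EuclideanSpace ℝ (Fin 3) => θ z.1 * ((p z.1 z.2 - π z.1 z.2) * ψ z.1 z.2))
          (((volume : Measure ℝ).restrict (Ioo 0 S)).prod (volume : Measure (EuclideanSpace ℝ (Fin 3)))) := by
        rw [← hprod]
        refine (iD.integrableOn (s := Ioo 0 S ×ˢ univ)).congr ?_
        exact (ae_restrict_mem (measurableSet_Ioo.prod MeasurableSet.univ)).mono fun z hz => hDF z hz
      rw [integral_prod _ iF]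
      refine integral_congr_ae (Eventually.of_forall fun t => ?_)
      simp only [hg]
      rw [← integral_const_mul]
    rw [← hDint]
    exact hD0
  -- ### Step 3: `g` is locally integrable on `(0, S)`
  have hstep3 : LocallyIntegrableOn g (Ioo 0 S) volume := by
    rw [locallyIntegrableOn_iff isOpen_Ioo.isLocallyClosed]
    intro k hk hkc
    -- the compact `k × tsupport φ` inside the strip
    set Kk : Set (ℝ × EuclideanSpace ℝ (Fin 3)) := k ×ˢ tsupport φ with hKk
    have hKkc : IsCompact Kk := hkc.prod hφc
    have hKkT : Kk ⊆ Ioo 0 T ×ˢ univ := prod_mono (hk.trans (Ioo_subset_Ioo_right hST.le)) (subset_univ _)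
    have hKkΩ : Kk ⊆ (Ω : Set (ℝ × EuclideanSpace ℝ (Fin 3))) := by
      rw [hΩset]; exact prod_mono hk (subset_univ _)
    -- `p - π` is integrable on `Kk`, `ψ` is bounded there
    have hq : IntegrableOn (uncurry p - uncurry π) Kk volume :=
      (hlocp.sub hlocπ).integrableOn_compact_subset hKkΩ hKkc
    obtain ⟨C, hC⟩ := hKkc.exists_bound_of_continuousOn (hψc.mono hKkT)
    have hψm : AEStronglyMeasurable (uncurry ψ) (volume.restrict Kk) :=
      (hψc.mono hKkT).aestronglyMeasurable hKkc.measurableSet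
    have hGKk : IntegrableOn (fun z : ℝ × EuclideanSpace ℝ (Fin 3) => uncurry ψ z * (uncurry p - uncurry π) z) Kk volume :=
      Integrable.bdd_mul hq hψm ((ae_restrict_mem hKkc.measurableSet).mono fun z hz => hC z hz)
    -- extend by zero to the strip `k × ℝ³`
    have hGk : IntegrableOn (fun z : ℝ × EuclideanSpace ℝ (Fin 3) => uncurry ψ z * (uncurry p - uncurry π) z)
        (k ×ˢ univ) volume := by
      refine hGKk.of_forall_sdiff_eq_zero (hkc.measurableSet.prod MeasurableSet.univ) fun z hz => ?_
      have hx : z.2 ∉ tsupport φ := fun h => hz.2 ⟨hz.1.1, h⟩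
      simp only [uncurry, hψK z.1 z.2 hx, zero_mul]
    have hGk' : Integrable (fun z : ℝ × EuclideanSpace ℝ (Fin 3) => uncurry ψ z * (uncurry p - uncurry π) z)
        (((volume : Measure ℝ).restrict k).prod (volume : Measure (EuclideanSpace ℝ (Fin 3)))) := by
      rw [← volume_restrict_prod_univ_eq_prod]; exact hGk
    have hgk := hGk'.integral_prod_left
    refine hgk.congr (Eventually.of_forall fun t => ?_)
    simp only [hg, uncurry, Pi.sub_apply]
    refine integral_congr_ae (Eventually.of_forall fun x => ?_)
    ring
  -- ### Step 4: `g = 0` a.e. on `(0, S)`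
  have hg0 : ∀ᵐ t ∂(volume : Measure ℝ), t ∈ Ioo 0 S → g t = 0 := by
    refine isOpen_Ioo.ae_eq_zero_of_integral_contDiff_smul_eq_zero hstep3 fun θ hθ hθc hθS => ?_
    have hzero : ∀ t, t ∉ Ioo 0 S → θ t • g t = 0 := fun t ht => by
      rw [image_eq_zero_of_notMem_tsupport (fun h => ht (hθS h)), zero_smul]
    rw [← setIntegral_eq_integral_of_forall_compl_eq_zero hzero]
    simp only [smul_eq_mul]
    exact hstep2 θ hθ hθc hθS
  -- ### Step 5: split `g(t) = ∫ p ψ - ∫ π ψ` for a.e. `t`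
  have hg0' : ∀ᵐ t ∂((volume : Measure ℝ).restrict (Ioo 0 S)), g t = 0 := by
    rw [ae_restrict_iff' measurableSet_Ioo]
    exact hg0
  filter_upwards [hg0', hsl, ae_restrict_mem measurableSet_Ioo] with t hgt hslt ht
  have htT : t ∈ Ioo 0 T := ⟨ht.1, ht.2.trans hST⟩
  -- the slice `ψ t` is continuous with compact support, hence in `L³`
  have hψtc : Continuous (ψ t) :=
    ((hV.contDiff_slice htT).continuous).inner hgφc
  have hψts : HasCompactSupport (ψ t) :=
    HasCompactSupport.intro hφc (fun x hx => hψK t x hx)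
  have hψt3 : MemLp (ψ t) 3 volume := hψtc.memLp_of_hasCompactSupport hψts
  -- `p t ψ t` and `π t ψ t` are integrable
  have hip : Integrable (fun x => p t x * ψ t x) volume := hslt.2.1.integrable_mul hψt3
  have hiπ : Integrable (fun x => π t x * ψ t x) volume := by
    refine Continuous.integrable_of_hasCompactSupport ?_ hψts.mul_left
    exact ((hcl.smooth_pressure.contDiff_slice htT).continuous).mul hψtc
  have hsplit : g t = (∫ x, p t x * ψ t x) - ∫ x, π t x * ψ t x := by
    rw [hg]
    dsimp only
    rw [← integral_sub hip hiπ]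
    refine integral_congr_ae (Eventually.of_forall fun x => ?_)
    ring
  rw [hsplit] at hgt
  linarith

/-- **Stein's bound for the classical pressure pairing, for a.e. time** (consequence of
`ae_pressure_pairing_eq` and Hölder's inequality; the control of the pressure term in the energy
estimate at spatial infinity, GIP 2003, proof of Thm. 2.1, (8); Lemarié-Rieusset 2016,
Prop. 6.2 / Def. 6.9): for a.e. `t ∈ (0, S)`,
`‖∫ π(t) ⟪V(t), ∇φ⟫‖ ≤ C_{3/2} ‖u(t)‖₃² ‖⟪V(t), ∇φ⟫‖₃`.
[cite: GallagherIftimiePlanchon2003, Thm. 2.1 (proof, (8))] [cite: LemarieRieusset2016, Prop. 6.2 and Def. 6.9] -/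
theorem ae_enorm_pressure_pairing_le (hν : 0 < ν) (hu : IsKatoSolutionOn T ν u₀ u) (hS : 0 < S)
    (hST : S < T) (hcl : IsClassicalNSSolutionOn (Ioo 0 T) ν 0 w π)
    (hwu : ∀ t ∈ Ioo 0 T, w t =ᵐ[volume] u t) (hV : IsSmoothSpaceTimeOn (Ioo 0 T) V)
    (hdivV : ∀ t ∈ Ioo 0 T, VectorCalculus.IsDivFree (V t)) (hφ : ContDiff ℝ (⊤ : ℕ∞) φ)
    (hφc : HasCompactSupport φ) :
    ∀ᵐ t ∂((volume : Measure ℝ).restrict (Ioo 0 S)),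
      ‖∫ x, π t x * ⟪V t x, gradient φ x⟫‖ₑ ≤
        steinConstThreeHalves * eLpNorm (u t) 3 volume ^ 2 *
          eLpNorm (fun x => ⟪V t x, gradient φ x⟫) 3 volume := by
  haveI hHT31 : ENNReal.HolderTriple (3 / 2) 3 1 := by
    refine ⟨?_⟩
    rw [ENNReal.inv_div (Or.inr (by norm_num)) (Or.inr (by norm_num)), inv_one,
      show (3 : ℝ≥0∞)⁻¹ = 1 / 3 by rw [one_div], ENNReal.div_add_div_same,
      show (2 : ℝ≥0∞) + 1 = 3 by norm_num, ENNReal.div_self (by norm_num) (by norm_num)]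
  obtain ⟨p, hsl, heq⟩ := ae_pressure_pairing_eq hν hu hS hST hcl hwu hV hdivV hφ hφc
  have hgφc : Continuous (gradient φ) := continuous_gradient_of_contDiff (hφ.of_le (by norm_cast))
  filter_upwards [hsl, heq, ae_restrict_mem measurableSet_Ioo] with t hslt heqt ht
  have htT : t ∈ Ioo 0 T := ⟨ht.1, ht.2.trans hST⟩
  have hψm : AEStronglyMeasurable (fun x => ⟪V t x, gradient φ x⟫) volume :=
    (((hV.contDiff_slice htT).continuous).inner hgφc).aestronglyMeasurable
  rw [heqt]
  calc ‖∫ x, p t x * ⟪V t x, gradient φ x⟫‖ₑ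
      ≤ ∫⁻ x, ‖p t x * ⟪V t x, gradient φ x⟫‖ₑ := enorm_integral_le_lintegral_enorm _
    _ = eLpNorm ((p t) • fun x => ⟪V t x, gradient φ x⟫) 1 volume := by
        rw [eLpNorm_one_eq_lintegral_enorm]
        rfl
    _ ≤ eLpNorm (p t) (3 / 2 : ℝ≥0∞) volume * eLpNorm (fun x => ⟪V t x, gradient φ x⟫) 3 volume :=
        eLpNorm_smul_le_mul_eLpNorm hψm hslt.1.1
    _ ≤ steinConstThreeHalves * eLpNorm (u t) 3 volume ^ 2 *
          eLpNorm (fun x => ⟪V t x, gradient φ x⟫) 3 volume :=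
        by gcongr; exact hslt.2

end Swap

end GIP2003

end Literature.Analysis.FluidPDE

end
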